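import Summits.CriticalPhenomena.PercolationContinuityZ3.Theorems.PercNearOneGluingNoHeavyLowerTailFibreSwitching
import HarnessLib

/-!
# Every three-configuration decision tree is an edgewise copy-permuting bijection

Helper file for crux `stmt-CriticalPhenomena-4575` (`NoHeavyLowerTail`), new-inequality factory seat
`prim-ineq-gen-1` (gen 5), FINDING-11 (Lean note).  Everything here is PROVED.

For the decision trees `DTree3` of `Literature.Probability.Percolation.DecisionTreeThreeConfig` (query an edge,
apply a history-dependent permutation of the three copies at it, recurse) we show, WITHOUT any validity
hypothesis:

* `mem_swap3_iff_exists_perm` / `permutesCopies_swap3` — at every coordinate the three output bits of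
  `swap3 T x` are a permutation of the three input bits (`DecisionTree.PermutesCopies (swap3 T)`);
* `swap3_injective` — `swap3 T` is injective on ALL triples (the path to an output is recovered bit by bit);
* `swap3_mem_triples` — it maps the triples inside `D` to triples inside `D`.

Consequently the fibre certificate principle `FibreSwitching.fibre_certificate_nonpos` applies verbatim to
families of decision-tree switchings (`fibre_certificate_nonpos_swap3`): a pointwise switching certificate
proves the FIBREWISE (coefficientwise) inequality, for every profile.  This is the form in which the
three-copy switching certificates for cubic connection-probability rows (e.g. prim-lit-2's PROOF-3PTLB for
`SHK3⁺`) yield comb positivity `M(·)`.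
-/

namespace Summit.CriticalPhenomena.PercolationContinuityZ3.Theorems

namespace FibreSwitching

open Finset
open Literature.Probability.Percolation.DecisionTree
open Literature.Probability.Percolation.DecisionTree.DTree3
open Literature.Probability.Percolation.DecisionTree.DTree2 (ins mem_ins)

noncomputable section

open Classical

variable {ι : Type*} [DecidableEq ι]

/-- **Decision-tree switchings permute the copies edgewise**: for every tree `T`, input `x` and coordinate
`i` there is a permutation `σ` of the copies with `i ∈ swap3 T x k ↔ i ∈ x (σ k)` for all `k`
(no validity hypothesis is needed). -/
theorem mem_swap3_iff_exists_perm (T : DTree3 ι) :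
    ∀ (x : Fin 3 → Finset ι) (i : ι), ∃ σ : Equiv.Perm (Fin 3), ∀ k, (i ∈ swap3 T x k ↔ i ∈ x (σ k)) := by
  induction T with
  | leaf π => intro x i; exact ⟨π, fun k => Iff.rfl⟩
  | node e π ch ih =>
      intro x i
      -- the child's output on the `e`-erased inputs never contains `e`
      set b : Fin 3 → Bool := fun j => decide (e ∈ x j) with hb
      set x' : Fin 3 → Finset ι := fun j => (x j).erase e with hx'
      by_cases hie : i = e
      · subst hie
        refine ⟨π, fun k => ?_⟩
        obtain ⟨σ', hσ'⟩ := ih b x' i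
        have hnot : i ∉ swap3 (ch b) x' k := fun h => by
          have := (hσ' k).1 h
          simp [hx'] at this
        show i ∈ ins i (decide (i ∈ x (π k))) (swap3 (ch b) x' k) ↔ i ∈ x (π k)
        rw [mem_ins]
        constructor
        · rintro (⟨-, h⟩ | h)
          · exact of_decide_eq_true h
          · exact (hnot h).elim
        · intro h; exact Or.inl ⟨rfl, decide_eq_true h⟩
      · obtain ⟨σ', hσ'⟩ := ih b x' i
        refine ⟨σ', fun k => ?_⟩
        show i ∈ ins e (decide (e ∈ x (π k))) (swap3 (ch b) x' k) ↔ i ∈ x (σ' k)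
        rw [mem_ins]
        constructor
        · rintro (⟨h, -⟩ | h)
          · exact (hie h).elim
          · have := (hσ' k).1 h
            simpa [hx', mem_erase, hie] using this
        · intro h
          exact Or.inr ((hσ' k).2 (by simpa [hx', mem_erase, hie] using h))

/-- `swap3 T` permutes the copies edgewise (`DecisionTree.PermutesCopies`). -/
theorem permutesCopies_swap3 (T : DTree3 ι) : PermutesCopies (swap3 T) :=
  fun x i => mem_swap3_iff_exists_perm T x i

/-- The output triple lies inside `D` whenever the input triple does. -/
theorem swap3_mem_triples (T : DTree3 ι) {D : Finset ι} {x : Fin 3 → Finset ι} (hx : x ∈ triples D) :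
    swap3 T x ∈ triples D := by
  rw [mem_triples] at hx ⊢
  intro k i hi
  obtain ⟨σ, hσ⟩ := mem_swap3_iff_exists_perm T x i
  exact hx (σ k) ((hσ k).1 hi)

/-- **Decision-tree switchings are injective** on all triples of configurations (the input is recovered
from the output by retracing the path: the revealed bits at the queried edge are read off the output,
which selects the child, and so on). -/
theorem swap3_injective (T : DTree3 ι) : Function.Injective (swap3 T) := by
  induction T with
  | leaf π =>
      intro x x' h
      funext j
      have := congrFun h (π.symm j)
      simpa [swap3] using this
  | node e π ch ih =>
      intro x x' h
      -- the bits at `e` agree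
      have hbits : ∀ j, (e ∈ x j ↔ e ∈ x' j) := by
        intro j
        obtain ⟨σ, hσ⟩ := mem_swap3_iff_exists_perm (node e π ch) x e
        obtain ⟨σ', hσ'⟩ := mem_swap3_iff_exists_perm (node e π ch) x' e
        -- at coordinate `e` both permutations are `π` in effect: use the defining equation directly
        have key : ∀ (y : Fin 3 → Finset ι) (k : Fin 3),
            (e ∈ swap3 (node e π ch) y k ↔ e ∈ y (π k)) := by
          intro y k
          obtain ⟨τ, hτ⟩ := mem_swap3_iff_exists_perm (ch fun j => decide (e ∈ y j))
            (fun j => (y j).erase e) e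
          have hnot : e ∉ swap3 (ch fun j => decide (e ∈ y j)) (fun j => (y j).erase e) k := fun h' => by
            have := (hτ k).1 h'; simp at this
          show e ∈ ins e (decide (e ∈ y (π k))) _ ↔ e ∈ y (π k)
          rw [mem_ins]
          constructor
          · rintro (⟨-, h⟩ | h)
            · exact of_decide_eq_true h
            · exact (hnot h).elim
          · intro h; exact Or.inl ⟨rfl, decide_eq_true h⟩
        have h1 := key x (π.symm j)
        have h2 := key x' (π.symm j)
        rw [h] at h1
        simp only [Equiv.apply_symm_apply] at h1 h2
        exact h1.symm.trans h2
      have hb : (fun j => decide (e ∈ x j)) = fun j => decide (e ∈ x' j) :=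
        funext fun j => by rw [decide_eq_decide]; exact hbits j
      -- the children's outputs agree off `e`, and neither contains `e`, so they are equal
      set y := fun j => (x j).erase e with hy
      set y' := fun j => (x' j).erase e with hy'
      have hnoe : ∀ (z : Fin 3 → Finset ι) (hz : ∀ j, e ∉ z j) (S : DTree3 ι) (k : Fin 3), e ∉ swap3 S z k := by
        intro z hz S k h'
        obtain ⟨τ, hτ⟩ := mem_swap3_iff_exists_perm S z e
        exact hz _ ((hτ k).1 h')
      have hchild : swap3 (ch fun j => decide (e ∈ x j)) y = swap3 (ch fun j => decide (e ∈ x j)) y' := by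
        funext k
        ext i
        have hk := congrFun h k
        -- unfold one step of `swap3` on both sides of `h`
        have hk' : ins e (decide (e ∈ x (π k))) (swap3 (ch fun j => decide (e ∈ x j)) y k) =
            ins e (decide (e ∈ x' (π k))) (swap3 (ch fun j => decide (e ∈ x' j)) y' k) := hk
        rw [← hb] at hk'
        by_cases hie : i = e
        · subst hie
          constructor
          · intro hi; exact (hnoe y (fun j => by simp [hy]) _ k hi).elim
          · intro hi; exact (hnoe y' (fun j => by simp [hy']) _ k hi).elim
        · have := congrArg (fun (S : Finset ι) => i ∈ S) hk'
          simp only [mem_ins, hie, false_and, false_or] at this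
          exact Iff.of_eq this
      have hyy : y = y' := ih _ hchild
      funext j
      ext i
      by_cases hie : i = e
      · subst hie; exact hbits j
      · have := congrArg (fun (z : Fin 3 → Finset ι) => i ∈ z j) hyy
        simp only [hy, hy', mem_erase, hie, ne_eq, not_false_eq_true, true_and] at this
        exact Iff.of_eq this

/-- **Fibre certificate principle for decision-tree switchings.**  For any finite family of trees `T b`,
potentials `lam0`, `lam b` on codes of triples with `lam0 (code x) + Σ_b lam b (code (swap3 (T b) x)) ≤ 0`
pointwise on the triples inside `D`, every FIBRE sum of `lam0 + Σ_b lam b` is `≤ 0` (hence, by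
`sum_wt3W_mul_nonneg_of_fibres`, also every product-law expectation — with no validity hypothesis). -/
theorem fibre_certificate_nonpos_swap3 (D : Finset ι) {K : Type*} (code : (Fin 3 → Finset ι) → K)
    (lam0 : K → ℝ) {β : Type*} (s : Finset β) (T : β → DTree3 ι) (lam : β → K → ℝ)
    (hpt : ∀ x ∈ triples D, lam0 (code x) + ∑ b ∈ s, lam b (code (swap3 (T b) x)) ≤ 0) (k : ι → ℕ) :
    ∑ x ∈ fibre D k, (lam0 (code x) + ∑ b ∈ s, lam b (code x)) ≤ 0 :=
  fibre_certificate_nonpos D code lam0 s (fun b => swap3 (T b)) (fun b _ => permutesCopies_swap3 (T b))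
    (fun b _ _ hx => swap3_mem_triples (T b) hx) (fun b _ => (swap3_injective (T b)).injOn) lam hpt k

end

end FibreSwitching

end Summit.CriticalPhenomena.PercolationContinuityZ3.Theorems
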